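import Literature.AlgebraicTopology.SingularHomology.SteenrodSquaresRelative
import Literature.AlgebraicTopology.SingularHomology.RelativeCochainsExcision
import Literature.AlgebraicTopology.SingularHomology.CohomologyHomotopyInvariance
import Literature.AlgebraicTopology.SingularHomology.CohomologyOfPoint
import Literature.AlgebraicTopology.Homotopy.UnreducedSuspension
import HarnessLib

/-!
# The suspension isomorphism in singular cohomology and the stability of the Steenrod squares

A. Hatcher, *Algebraic Topology* (2002), §2.1 Exercise 20 / §3.1 (dualised): for the unreduced
suspension `SP` of a nonempty space `P` there are natural isomorphisms `Hᵏ(P) ≅ Hᵏ⁺¹(SP)` for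
`k ≥ 1`; §4.L, property (1) of the Steenrod squares and "stability": `Sq` commutes with the
suspension isomorphism — which at the cochain level is the commutation of `Sq` with the
coboundary of a pair (Steenrod 1947, §7).

For the tree's singular cohomology, the unreduced suspension `Susp P` of
`Literature/AlgebraicTopology/Homotopy/UnreducedSuspension.lean`, and the Steenrod squares of
`SteenrodSquares(Relative).lean`, we PROVE:

* `isZero_singularCohomology_of_contractibleSpace`: `Hⁿ(X; M) = 0` for `X` contractible, `n ≠ 0`;
* `relSingularCohomology.isIso_δ_of_contractibleSpace`, `…isIso_toAbsolute_of_contractibleSpace`: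
  for a contractible ambient space (resp. contractible subspace) the coboundary
  `δ : Hᵏ(B) → Hᵏ⁺¹(T, B)` (resp. `Hᵏ⁺¹(Z, C) → Hᵏ⁺¹(Z)`) is an isomorphism for `k ≥ 1`
  (exactness of the sequence of the pair);
* **`suspensionIso R M P k hk : Hᵏ(P; M) ≅ Hᵏ⁺¹(Susp P; M)`** (`k ≠ 0`, `P` nonempty), the
  zigzag `Hᵏ(P) ≅ Hᵏ(band) →δ≅ Hᵏ⁺¹(upperThick, band) ←exc≅ Hᵏ⁺¹(Susp P, lower) →≅ Hᵏ⁺¹(Susp P)`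
  (homotopy equivalence `P ≃ₕ band`; `δ` of the pair (thick upper cone, band), an isomorphism
  since the cone is contractible; EXCISION `RelativeCochainsExcision.lean` for the cones whose
  interiors cover; `Hᵏ⁺¹(Susp P, lower) ≅ Hᵏ⁺¹(Susp P)` since the lower cone is contractible);
* **`suspensionIso_steenrodSqLower`**: `Σ ∘ Sq_{n,i} = Sq_{n+1,i+1} ∘ Σ` on `Hᵖ(P; R)`
  (`R` of characteristic two), i.e. `Σ Sqᵏ = Sqᵏ Σ` in the upper indexing — from the naturality
  of the squares under maps (of pairs), their compatibility with `Hⁿ(X, A) → Hⁿ(X)` and their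
  commutation with `δ` (`relSteenrodSqLower_δ`).

Everything is proved; no named facts.

## References

* A. Hatcher, *Algebraic Topology*, CUP 2002, §2.1 Exercise 20, §3.1 p. 201, §4.L (stability of
  `Sq`). [Hatcher2002]
* N. E. Steenrod, *Products of cocycles and extensions of mappings*, Ann. of Math. 48 (1947),
  §7. [Steenrod1947]
-/

noncomputable section

open CategoryTheory Limits
open Literature.AlgebraicTopology.Homotopy

universe u v

namespace Literature.AlgebraicTopology.SingularHomology

variable (R : Type v) [CommRing R] (M : Type v) [AddCommGroup M] [Module R M]

/-! ### Cohomology of contractible spaces; the coboundary of a pair with contractible pieces -/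

/-- **The positive-degree cohomology of a contractible space vanishes** (Hatcher 2002, §3.1
p. 201 with p. 199: `Hⁿ(pt) = 0` for `n > 0`). [cite: Hatcher2002, §3.1 p. 201] -/
theorem isZero_singularCohomology_of_contractibleSpace (X : Type u) [TopologicalSpace X]
    [ContractibleSpace X] {n : ℕ} (hn : n ≠ 0) : IsZero (singularCohomology R M X n) :=
  (singularCochainComplex.isZero_singularCohomology_of_subsingleton' (R := R) (M := M)
    (X := PUnit.{u + 1}) hn).of_iso
    (singularCohomology.isoOfContractible R M X n).symm

namespace relSingularCohomology

variable {T : Type u} [TopologicalSpace T]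

/-- **For a contractible ambient space the coboundary of the pair is an isomorphism in positive
degrees**: `δ : Hᵏ(B) ≅ Hᵏ⁺¹(T, B)` for `k ≥ 1` (exactness of
`Hᵏ(T) → Hᵏ(B) → Hᵏ⁺¹(T, B) → Hᵏ⁺¹(T)` with `Hᵏ(T) = Hᵏ⁺¹(T) = 0`; Hatcher 2002, §3.1 p. 200).
[cite: Hatcher2002, §3.1 p. 200] -/
theorem isIso_δ_of_contractibleSpace [ContractibleSpace T] (B : Set T) {i j : ℕ}
    (hij : i + 1 = j) (hi : i ≠ 0) : IsIso (δ R M T B i j hij) := by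
  have h1 : IsZero (singularCohomology R M T i) :=
    isZero_singularCohomology_of_contractibleSpace R M T hi
  have h2 : IsZero (singularCohomology R M T j) :=
    isZero_singularCohomology_of_contractibleSpace R M T (by omega)
  haveI : Mono (δ R M T B i j hij) := (exact_map_δ (R := R) (M := M) B i j hij).mono_g (h1.eq_of_src _ _)
  haveI : Epi (δ R M T B i j hij) := (exact_δ_toAbsolute (R := R) (M := M) B i j hij).epi_f (h2.eq_of_tgt _ _)
  exact isIso_of_mono_of_epi _

/-- **For a contractible subspace the relative groups are the absolute ones in positive
degrees**: `Hʲ(T, C) ≅ Hʲ(T)` for `j ≥ 2` (and an isomorphism for `j = i + 1`, `i ≥ 1`; exactness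
with `Hⁱ(C) = Hʲ(C) = 0`; Hatcher 2002, §3.1 p. 200). [cite: Hatcher2002, §3.1 p. 200] -/
theorem isIso_toAbsolute_of_contractibleSpace (C : Set T) [ContractibleSpace C] {i j : ℕ}
    (hij : i + 1 = j) (hi : i ≠ 0) : IsIso (toAbsolute R M T C j) := by
  have h1 : IsZero (singularCohomology R M C i) :=
    isZero_singularCohomology_of_contractibleSpace R M C hi
  have h2 : IsZero (singularCohomology R M C j) :=
    isZero_singularCohomology_of_contractibleSpace R M C (by omega)
  haveI : Mono (toAbsolute R M T C j) :=
    (exact_δ_toAbsolute (R := R) (M := M) C i j hij).mono_g (h1.eq_of_src _ _)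
  haveI : Epi (toAbsolute R M T C j) :=
    (exact_toAbsolute_map (R := R) (M := M) C j).epi_f (h2.eq_of_tgt _ _)
  exact isIso_of_mono_of_epi _

end relSingularCohomology

/-! ### The suspension isomorphism -/

section Suspension

variable (P : Type u) [TopologicalSpace P] [Nonempty P]

/-- **Excision for the cones of the suspension**: the map of pairs
`(upperThick, band) → (Susp P, lower)` induces isomorphisms on relative cohomology (the interiors
of the two cones cover). [cite: Hatcher2002, §3.1 p. 201] -/
instance isIso_map_upperThick (n : ℕ) :
    IsIso (relSingularCohomology.map R M (subsetIncl (Susp.upperThick P))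
      (Set.mapsTo_preimage Subtype.val (Susp.lower P)) n) :=
  relSingularCohomology.isIso_map_subsetIncl_of_interior R M (Susp.lower P) (Susp.upperThick P)
    Susp.interior_lower_union_interior_upperThick n

/-- `δ : Hᵏ(band) → Hᵏ⁺¹(upperThick, band)` is an isomorphism for `k ≥ 1` (the thick upper cone
is contractible). [cite: Hatcher2002, §3.1 p. 200] -/
instance isIso_δ_band {k : ℕ} [NeZero k] :
    IsIso (relSingularCohomology.δ R M (Susp.upperThick P) (Susp.band P) k (k + 1) rfl) :=
  relSingularCohomology.isIso_δ_of_contractibleSpace R M (Susp.band P) rfl (NeZero.ne k)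

/-- `Hᵏ⁺¹(Susp P, lower) → Hᵏ⁺¹(Susp P)` is an isomorphism for `k ≥ 1` (the lower cone is
contractible). [cite: Hatcher2002, §3.1 p. 200] -/
instance isIso_toAbsolute_lower {k : ℕ} [NeZero k] :
    IsIso (relSingularCohomology.toAbsolute R M (Susp P) (Susp.lower P) (k + 1)) :=
  relSingularCohomology.isIso_toAbsolute_of_contractibleSpace R M (Susp.lower P) (i := k) rfl
    (NeZero.ne k)

/-- **The suspension isomorphism** `Hᵏ(P; M) ≅ Hᵏ⁺¹(SP; M)` for `k ≥ 1` and `P` nonempty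
(Hatcher 2002, §2.1 Exercise 20, dualised), as the zigzag
`Hᵏ(P) ≅ Hᵏ(band) →δ Hᵏ⁺¹(upperThick, band) ←exc Hᵏ⁺¹(SP, lower) → Hᵏ⁺¹(SP)`.
[cite: Hatcher2002, §2.1 Exercise 20] -/
def suspensionIso (k : ℕ) [NeZero k] :
    singularCohomology R M P k ≅ singularCohomology R M (Susp P) (k + 1) :=
  (singularCohomology.isoOfHomotopyEquiv' R M (Susp.bandHomotopyEquiv (P := P)) k).symm ≪≫
    asIso (relSingularCohomology.δ R M (Susp.upperThick P) (Susp.band P) k (k + 1) rfl) ≪≫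
    (asIso (relSingularCohomology.map R M (subsetIncl (Susp.upperThick P))
      (Set.mapsTo_preimage Subtype.val (Susp.lower P)) (k + 1))).symm ≪≫
    asIso (relSingularCohomology.toAbsolute R M (Susp P) (Susp.lower P) (k + 1))

end Suspension

/-! ### Stability of the Steenrod squares under suspension -/

section Stability

variable {R} [CharP R 2] (P : Type u) [TopologicalSpace P] [Nonempty P]

omit [CharP R 2] in
/-- Transport of a commutation relation through inverses of isomorphisms (bookkeeping).
[folklore] -/
lemma inv_comm_of_hom_comm {A B A' B' : ModuleCat.{max u v} R} (e : A ≅ B) (e' : A' ≅ B')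
    (f : A →+ A') (g : B →+ B') (h : ∀ a, e'.hom (f a) = g (e.hom a)) (b : B) :
    e'.inv (g b) = f (e.inv b) := by
  obtain ⟨a, rfl⟩ : ∃ a, b = e.hom a :=
    ⟨e.inv b, by rw [← ModuleCat.comp_apply, Iso.inv_hom_id]; rfl⟩
  rw [← h, ← ModuleCat.comp_apply, Iso.hom_inv_id, ← ModuleCat.comp_apply, Iso.hom_inv_id]
  rfl

/-- **`Sq` commutes with the suspension isomorphism** (Hatcher 2002, §4.L, property (1) with
stability; Steenrod 1947, §7): for `x ∈ Hᵖ(P; R)`, `p ≥ 1`, `n ≥ 1`,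
`Σ(Sq_{n,i} x) = Sq_{n+1,i+1}(Σ x)` — in the upper indexing `Σ Sqᵏ = Sqᵏ Σ`. Proof: the four
steps of the zigzag commute with the squares (`steenrodSqLower_map` for the homotopy
equivalence, `relSteenrodSqLower_δ`, `relSteenrodSqLower_map` for the excision,
`toAbsolute_relSteenrodSqLower`). [cite: Hatcher2002, §4.L] -/
theorem suspensionIso_steenrodSqLower {p : ℕ} [NeZero p] (n i : ℕ) [NeZero n]
    (x : singularCohomology R R P p) :
    (suspensionIso R R P n).hom (steenrodSqLower P p n i x) =
      steenrodSqLower (Susp P) (p + 1) (n + 1) (i + 1) ((suspensionIso R R P p).hom x) := by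
  -- names for the four steps in degrees `p` and `n`
  set eP := singularCohomology.isoOfHomotopyEquiv' R R (Susp.bandHomotopyEquiv (P := P)) p
  set eN := singularCohomology.isoOfHomotopyEquiv' R R (Susp.bandHomotopyEquiv (P := P)) n
  set δP := relSingularCohomology.δ R R (Susp.upperThick P) (Susp.band P) p (p + 1) rfl
  set δN := relSingularCohomology.δ R R (Susp.upperThick P) (Susp.band P) n (n + 1) rfl
  set xP := asIso (relSingularCohomology.map R R (subsetIncl (Susp.upperThick P))
      (Set.mapsTo_preimage Subtype.val (Susp.lower P)) (p + 1))
  set xN := asIso (relSingularCohomology.map R R (subsetIncl (Susp.upperThick P))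
      (Set.mapsTo_preimage Subtype.val (Susp.lower P)) (n + 1))
  set aP := relSingularCohomology.toAbsolute R R (Susp P) (Susp.lower P) (p + 1)
  set aN := relSingularCohomology.toAbsolute R R (Susp P) (Susp.lower P) (n + 1)
  change aN (xN.inv (δN (eN.inv (steenrodSqLower P p n i x)))) =
    steenrodSqLower (Susp P) (p + 1) (n + 1) (i + 1) (aP (xP.inv (δP (eP.inv x))))
  -- step 1: the homotopy equivalence (inverse of `toBand^*`)
  have h1 : eN.inv (steenrodSqLower P p n i x) =
      steenrodSqLower (Susp.band P) p n i (eP.inv x) :=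
    inv_comm_of_hom_comm (R := R) eP eN (steenrodSqLower _ p n i) (steenrodSqLower P p n i)
      (fun a => steenrodSqLower_map (Susp.toBand P) n i a) _
  -- step 2: the coboundary
  have h2 : δN (steenrodSqLower (Susp.band P) p n i (eP.inv x)) =
      relSteenrodSqLower (Susp.upperThick P) (p + 1) (Susp.band P) (n + 1) (i + 1) (δP (eP.inv x)) :=
    (relSteenrodSqLower_δ n i (eP.inv x)).symm
  -- step 3: excision (inverse)
  have h3 : xN.inv (relSteenrodSqLower (Susp.upperThick P) (p + 1) (Susp.band P) (n + 1) (i + 1)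
      (δP (eP.inv x))) =
      relSteenrodSqLower (Susp P) (p + 1) (Susp.lower P) (n + 1) (i + 1) (xP.inv (δP (eP.inv x))) :=
    inv_comm_of_hom_comm (R := R) xP xN (relSteenrodSqLower _ (p + 1) _ (n + 1) (i + 1))
      (relSteenrodSqLower _ (p + 1) _ (n + 1) (i + 1))
      (fun a => relSteenrodSqLower_map (subsetIncl (Susp.upperThick P)) _ (n + 1) (i + 1) a) _
  -- step 4: to absolute cohomology
  have h4 : aN (relSteenrodSqLower (Susp P) (p + 1) (Susp.lower P) (n + 1) (i + 1)
      (xP.inv (δP (eP.inv x)))) =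
      steenrodSqLower (Susp P) (p + 1) (n + 1) (i + 1) (aP (xP.inv (δP (eP.inv x)))) :=
    toAbsolute_relSteenrodSqLower (n + 1) (i + 1) _
  rw [h1, h2, h3, h4]

/-- **`Σ Sqᵏ = Sqᵏ Σ`** in the upper indexing: for `x ∈ Hᵖ(P; R)`, `p ≥ 1`,
`Σ(Sqᵏ x) = Sqᵏ(Σ x)` in `H^{p+1+k}(SP; R)` (Hatcher 2002, §4.L). [cite: Hatcher2002, §4.L] -/
theorem suspensionIso_steenrodSq {p : ℕ} [NeZero p] (k : ℕ) (x : singularCohomology R R P p) :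
    haveI : NeZero (p + k) := ⟨by have := NeZero.ne p; omega⟩
    (suspensionIso R R P (p + k)).hom (steenrodSq P p k x) =
      steenrodSqLower (Susp P) (p + 1) (p + k + 1) (p - k + 1) ((suspensionIso R R P p).hom x) :=
  suspensionIso_steenrodSqLower P (p + k) (p - k) x

end Stability

end Literature.AlgebraicTopology.SingularHomology
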